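import Summits.QuantumFields.YangMills.Theorems.ReplicaVarianceTiltHeightChiSqLEmlDTangentFloor
import Summits.QuantumFields.YangMills.Theorems.ReplicaVarianceTiltHeightChiSqLHaarDominatedMatrix
import Literature.MathematicalPhysics.QuantumFieldTheory.Balaban1983to89.BlockAveragingExpMeanLogContinuous

/-!
# Route `ReplicaVarianceTilt` — crux `HeightChiSqL` (stmt-QuantumFields-26133), toward the residual of `stub_acIntegrable`:
# the exp-mean-log fibre map on `SU(2)` is `SU(2)`-valued, its cone extension has a uniformly floored fibre derivative, and it has a
# UNIFORM INJECTIVITY RADIUS over the closed guard (helper `--supports stmt-QuantumFields-26133`)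

Width seat `ym-line-sfw-p2-w3` gen 21 (home cell `ym-idea-1`; R3 RECORD rung — no summit, no rung and no crux is proved here; the YM mass
gap is NOT proved by any of this).  Pure calculus / topology over Mathlib and the tree (`T4EMLTangentInjective`, `T4HaarSU2LocalDiffeo`,
`T4QuatExpLog`, `BlockAveragingExpMeanLog`); every declaration is [folklore].  Input (b) of the quantitative Lemma A
`…HeightChiSqLHaarDominatedMatrix.haar_restrict_map_le_smul_of_matrix` for the guarded exp-mean-log fibre laws:
* §1 `trace_mlog_eq_zero_of_lt_half`, `Kmat_mem_specialUnitaryGroup` — for `hᵢ, W ∈ SU(2)` with `‖hᵢ W* − 1‖ < 1/2`,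
  `Kmat h c W = exp(Σᵢ cᵢ log(hᵢ W*))·W ∈ SU(2)` (skew-Hermitian traceless exponent; `ExpMeanLog.exp_smul_mem_specialUnitaryGroup`).
* §2 `contDiffAt_cone` — the cone extension `(h, x) ↦ ‖x‖·topRowQuat (Kmat h c (quatMatrix (x/‖x‖)))` is jointly `C¹`
  (`HeightChiSqLEmlDContinuous.analyticOnNhd_Kmat`); `exists_fibreDeriv_floor` — at unit points over the closed guard `≤ 1/3` its fibre
  derivative has the uniform floor `c₀` of `HeightChiSqLEmlDTangentFloor.exists_uniform_tangent_floor` (cone lemma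
  `HeightChiSqLHaarDominated.exists_hasStrictFDerivAt_coneExt_lower`, dictionary `T4HaarSU2LocalDiffeo.apply_quatMatrix_eq_of_tangent`, §1).
* §3 `exists_injOn_nhds` — `(h, x) ↦ (h, cone extension)` has invertible strict derivative there, hence is injective on an open neighbourhood
  (Mathlib `HasStrictFDerivAt.toOpenPartialHomeomorph`); `isCompact_unitGuard`; `exists_uniform_injRadius` (Lebesgue number of that cover of
  the compact unit guard) and its matrix form **`exists_uniform_injRadius_su2`: there is `r > 0` such that for ALL `hᵢ ∈ SU(2)` and
  `W₁, W₂ ∈ SU(2)` in the closed guard with `‖W₁ − W₂‖ < r`, `Kmat h c W₁ = Kmat h c W₂ ⟹ W₁ = W₂`.**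
WHAT IS LEFT (next files): finite `r/2`-cover of `SU(2)` + floor ⟹ `haar_restrict_map_le_smul_of_matrix` ⟹ the stub.  No estimate of Bałaban's is used.
-/

noncomputable section

open NormedSpace Set Filter Topology Function Metric

namespace Summit.QuantumFields.YangMills.Theorems.HeightChiSqLEmlInjectivity

open scoped Matrix Matrix.Norms.L2Operator RealInnerProductSpace Quaternion
open Literature.MathematicalPhysics.QuantumFieldTheory.Balaban1983to89.T4EMLTangentInjective
  (Kmat emlD hasStrictFDerivAt_Kmat star_mlog_of_unitary)
open Literature.MathematicalPhysics.QuantumFieldTheory.Balaban1983to89.MatrixLog (mlog exp_mlog norm_mlog_le_two_mul)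
open Literature.MathematicalPhysics.QuantumFieldTheory.Balaban1983to89.ExpMeanLog (exp_smul_mem_specialUnitaryGroup)
open Literature.Analysis.Matrix (det_exp_eq_exp_trace)
open Literature.MathematicalPhysics.QuantumFieldTheory.Balaban1983to89 (MatrixNorms.norm_ntr_le_opNorm)

/-! ## 1. The exp-mean-log fibre map is `SU(2)`-valued on the guard `‖hᵢ W* − 1‖ < 1/2` -/

section SUValued

/-- `tr log X = 0` for `X ∈ SU(2)` with `‖X − 1‖ < 1/2` (`e^{tr log X} = det X = 1` and `|tr log X| ≤ 2‖log X‖ ≤ 4‖X − 1‖ < 2π`).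
[folklore] -/
theorem trace_mlog_eq_zero_of_lt_half {X : Matrix (Fin 2) (Fin 2) ℂ} (hX : X ∈ Matrix.specialUnitaryGroup (Fin 2) ℂ)
    (hs : ‖X - 1‖ < 1 / 2) : (mlog X).trace = 0 := by
  have hX1 : ‖X - 1‖ < 1 := lt_trans hs (by norm_num)
  have hexp : Complex.exp (mlog X).trace = 1 := by
    rw [Complex.exp_eq_exp_ℂ, ← det_exp_eq_exp_trace, exp_mlog hX1]
    exact (Matrix.mem_specialUnitaryGroup_iff.1 hX).2
  obtain ⟨k, hk⟩ := Complex.exp_eq_one_iff.1 hexp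
  have hbd : ‖(mlog X).trace‖ < 2 * Real.pi := by
    have h1 : ‖(mlog X).trace‖ ≤ Fintype.card (Fin 2) * ‖mlog X‖ := by
      have hc : (0 : ℝ) < Fintype.card (Fin 2) := Nat.cast_pos.mpr Fintype.card_pos
      have h : ‖(mlog X).trace / (Fintype.card (Fin 2) : ℂ)‖ ≤ ‖mlog X‖ := MatrixNorms.norm_ntr_le_opNorm (mlog X)
      rw [norm_div, Complex.norm_natCast, div_le_iff₀ hc] at h
      linarith [mul_comm (Fintype.card (Fin 2) : ℝ) ‖mlog X‖]
    have h2 : ‖mlog X‖ ≤ 2 * ‖X - 1‖ := norm_mlog_le_two_mul hs.le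
    rw [Fintype.card_fin] at h1
    push_cast at h1
    nlinarith [Real.pi_gt_three]
  have hk0 : k = 0 := by
    have h2π : ‖(k : ℂ) * (2 * Real.pi * Complex.I)‖ < 2 * Real.pi := by rw [← hk]; exact hbd
    have hn : ‖(2 * Real.pi * Complex.I : ℂ)‖ = 2 * Real.pi := by
      simp [abs_of_pos Real.pi_pos]
    rw [norm_mul, hn, Complex.norm_intCast] at h2π
    have hk1 : |(k : ℝ)| < 1 := (mul_lt_iff_lt_one_left (by positivity)).1 h2π
    have : |k| < 1 := by exact_mod_cast hk1
    exact Int.abs_lt_one_iff.1 this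
  rw [hk, hk0]
  simp

variable {ι : Type*} [Fintype ι]

/-- **`SU(2)`-VALUEDNESS OF THE EXP-MEAN-LOG FIBRE MAP**: for `hᵢ, W ∈ SU(2)` with `‖hᵢ W* − 1‖ < 1/2` and real weights `cᵢ`,
`Kmat h c W = exp(Σᵢ cᵢ log(hᵢ W*))·W ∈ SU(2)` (the exponent is skew-Hermitian and traceless). [folklore] -/
theorem Kmat_mem_specialUnitaryGroup (h : ι → Matrix (Fin 2) (Fin 2) ℂ) (c : ι → ℝ)
    (hh : ∀ i, h i ∈ Matrix.specialUnitaryGroup (Fin 2) ℂ) {W : Matrix (Fin 2) (Fin 2) ℂ}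
    (hW : W ∈ Matrix.specialUnitaryGroup (Fin 2) ℂ) (hg : ∀ i, ‖h i * star W - 1‖ < 1 / 2) :
    Kmat h c W ∈ Matrix.specialUnitaryGroup (Fin 2) ℂ := by
  have hWu : W ∈ Matrix.unitaryGroup (Fin 2) ℂ := (Matrix.mem_specialUnitaryGroup_iff.1 hW).1
  have hsW : star W ∈ Matrix.specialUnitaryGroup (Fin 2) ℂ := by
    rw [Matrix.mem_specialUnitaryGroup_iff]
    refine ⟨?_, ?_⟩
    · exact Matrix.mem_unitaryGroup_iff.2 (by
        rw [star_star]; exact Matrix.mem_unitaryGroup_iff'.1 hWu)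
    · rw [Matrix.star_eq_conjTranspose, Matrix.det_conjTranspose, (Matrix.mem_specialUnitaryGroup_iff.1 hW).2, star_one]
  have hP : ∀ i, h i * star W ∈ Matrix.specialUnitaryGroup (Fin 2) ℂ := fun i => mul_mem (hh i) hsW
  have hZs : ∀ i, star (mlog (h i * star W)) = -mlog (h i * star W) := fun i =>
    star_mlog_of_unitary (Matrix.mem_specialUnitaryGroup_iff.1 (hP i)).1 (hg i)
  have hZt : ∀ i, (mlog (h i * star W)).trace = 0 := fun i => trace_mlog_eq_zero_of_lt_half (hP i) (hg i)
  set Y : Matrix (Fin 2) (Fin 2) ℂ := ∑ i, (c i : ℂ) • mlog (h i * star W) with hY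
  have hYs : star Y = -Y := by
    simp only [hY, star_sum, star_smul, Complex.star_def, Complex.conj_ofReal, hZs, smul_neg, Finset.sum_neg_distrib]
  have hYt : Y.trace = 0 := by
    simp only [hY, Matrix.trace_sum, Matrix.trace_smul, hZt, smul_zero, Finset.sum_const_zero]
  have hexpY : exp Y ∈ Matrix.specialUnitaryGroup (Fin 2) ℂ := by
    have := exp_smul_mem_specialUnitaryGroup hYs hYt 1
    rwa [Complex.ofReal_one, one_smul] at this
  show exp Y * W ∈ Matrix.specialUnitaryGroup (Fin 2) ℂ
  exact mul_mem hexpY hW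

end SUValued

/-! ## 2. The cone extension in the quaternion picture: joint smoothness, floor of the fibre derivative, local injectivity -/

section Cone

open Literature.MathematicalPhysics.QuantumFieldTheory.Balaban1983to89.T4HaarSU2LocalDiffeo
  (topRowQuat topRowQuat_quatMatrix topRowQuat_coe quatMatrixCLM quatMatrixCLM_apply quatMatrix_tangent apply_quatMatrix_eq_of_tangent)
open Literature.MathematicalPhysics.QuantumFieldTheory.Balaban1983to89.T4QuatExpLog (norm_quatMatrix quatMatrix_sub)
open Literature.MathematicalPhysics.QuantumLattice (quatMatrix su2Quat norm_su2Quat quatToSU2 coe_quatToSU2_of_norm_eq_one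
  quatMatrix_su2Quat quatToSU2_su2Quat)
open Literature.Geometry.GaugeTheory (quatMatrix_zero)
open Summit.QuantumFields.YangMills.Theorems.HeightChiSqLEmlDContinuous (isOpen_emlDomain analyticOnNhd_Kmat)
open Summit.QuantumFields.YangMills.Theorems.HeightChiSqLEmlDTangentFloor (exists_uniform_tangent_floor)
open Summit.QuantumFields.YangMills.Theorems.HeightChiSqLHaarDominated (exists_hasStrictFDerivAt_coneExt_lower)

variable {ι : Type*} [Fintype ι]

/-- **JOINT SMOOTHNESS OF THE CONE EXTENSION** `(h, x) ↦ ‖x‖ • topRowQuat (Kmat h c (quatMatrix (x/‖x‖)))` at every `(h, x)` with `x ≠ 0`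
and `‖hᵢ (quatMatrix (x/‖x‖))* − 1‖ < 1` (joint analyticity of `Kmat`, `HeightChiSqLEmlDContinuous.analyticOnNhd_Kmat`). [folklore] -/
theorem contDiffAt_cone (c : ι → ℝ) {p : (ι → Matrix (Fin 2) (Fin 2) ℂ) × ℍ} (hp0 : p.2 ≠ 0)
    (hg : ∀ i, ‖p.1 i * star (quatMatrix (‖p.2‖⁻¹ • p.2)) - 1‖ < 1) :
    ContDiffAt ℝ 1 (fun q : (ι → Matrix (Fin 2) (Fin 2) ℂ) × ℍ =>
      ‖q.2‖ • topRowQuat (Kmat q.1 c (quatMatrix (‖q.2‖⁻¹ • q.2)))) p := by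
  -- the inner map `q ↦ (q.1, quatMatrix (q.2/‖q.2‖))`
  have hnorm : ContDiffAt ℝ 1 (fun q : (ι → Matrix (Fin 2) (Fin 2) ℂ) × ℍ => ‖q.2‖) p :=
    (contDiffAt_norm ℝ hp0).comp p contDiffAt_snd
  have hrad : ContDiffAt ℝ 1 (fun q : (ι → Matrix (Fin 2) (Fin 2) ℂ) × ℍ => ‖q.2‖⁻¹ • q.2) p :=
    (hnorm.inv (norm_ne_zero_iff.2 hp0)).smul contDiffAt_snd
  have hqm : ContDiffAt ℝ 1 (fun q : (ι → Matrix (Fin 2) (Fin 2) ℂ) × ℍ => quatMatrix (‖q.2‖⁻¹ • q.2)) p := by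
    have e : (fun q : (ι → Matrix (Fin 2) (Fin 2) ℂ) × ℍ => quatMatrix (‖q.2‖⁻¹ • q.2)) =
        fun q => quatMatrixCLM (‖q.2‖⁻¹ • q.2) := by funext q; rw [quatMatrixCLM_apply]
    rw [e]
    exact quatMatrixCLM.contDiff.contDiffAt.comp p hrad
  have hG : ContDiffAt ℝ 1 (fun q : (ι → Matrix (Fin 2) (Fin 2) ℂ) × ℍ => (q.1, quatMatrix (‖q.2‖⁻¹ • q.2))) p :=
    contDiffAt_fst.prodMk hqm
  -- `Kmat` is `C¹` at the image point
  have hdom := isOpen_emlDomain (m := Fin 2) (ι := ι)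
  have hK : ContDiffAt ℝ 1 (fun q : (ι → Matrix (Fin 2) (Fin 2) ℂ) × Matrix (Fin 2) (Fin 2) ℂ => Kmat q.1 c q.2)
      (p.1, quatMatrix (‖p.2‖⁻¹ • p.2)) :=
    ((analyticOnNhd_Kmat (m := Fin 2) c).contDiffOn hdom.uniqueDiffOn).contDiffAt (hdom.mem_nhds hg)
  have hKG : ContDiffAt ℝ 1 (fun q : (ι → Matrix (Fin 2) (Fin 2) ℂ) × ℍ => Kmat q.1 c (quatMatrix (‖q.2‖⁻¹ • q.2))) p := by
    have := hK.comp p hG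
    exact this
  exact hnorm.smul (topRowQuat.contDiff.contDiffAt.comp p hKG)

/-- **THE FIBRE DERIVATIVE OF THE CONE EXTENSION HAS THE UNIFORM FLOOR** at unit points over the closed guard: with `c₀` the uniform tangent floor
of `HeightChiSqLEmlDTangentFloor.exists_uniform_tangent_floor` (weights `cᵢ ≥ 0`, `Σ cᵢ < 1`, `δ = 1/3`), for `hᵢ ∈ SU(2)` and a unit quaternion `u`
with `‖hᵢ (quatMatrix u)* − 1‖ ≤ 1/3`, the map `x ↦ ‖x‖ • topRowQuat (Kmat h c (quatMatrix (x/‖x‖)))` has a strict derivative `D` at `u` with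
`c₀‖v‖ ≤ ‖D v‖` for all `v`. [folklore] -/
theorem exists_fibreDeriv_floor (c : ι → ℝ) {c₀ : ℝ} (hc0 : 0 < c₀) (hc1 : c₀ ≤ 1)
    (hfloor : ∀ (h : ι → Matrix (Fin 2) (Fin 2) ℂ) (W : Matrix (Fin 2) (Fin 2) ℂ),
      (∀ i, h i ∈ Matrix.unitaryGroup (Fin 2) ℂ) → W ∈ Matrix.unitaryGroup (Fin 2) ℂ → (∀ i, ‖h i * star W - 1‖ ≤ 1 / 3) →
        ∀ X : Matrix (Fin 2) (Fin 2) ℂ, Xᴴ = -X → c₀ * ‖X‖ ≤ ‖emlD h c W (W * X)‖)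
    (h : ι → Matrix (Fin 2) (Fin 2) ℂ) (hh : ∀ i, h i ∈ Matrix.specialUnitaryGroup (Fin 2) ℂ)
    {u : ℍ} (hu : ‖u‖ = 1) (hg : ∀ i, ‖h i * star (quatMatrix u) - 1‖ ≤ 1 / 3) :
    ∃ D : ℍ →L[ℝ] ℍ, HasStrictFDerivAt (fun x : ℍ => ‖x‖ • topRowQuat (Kmat h c (quatMatrix (‖x‖⁻¹ • x)))) D u ∧
      ∀ v, c₀ * ‖v‖ ≤ ‖D v‖ := by
  have hu0 : u ≠ 0 := fun h0 => by rw [h0, norm_zero] at hu; exact zero_ne_one hu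
  have huu : ‖u‖⁻¹ • u = u := by rw [hu, inv_one, one_smul]
  have hW : quatMatrix u = ((quatToSU2 u : Matrix.specialUnitaryGroup (Fin 2) ℂ) : Matrix (Fin 2) (Fin 2) ℂ) :=
    (coe_quatToSU2_of_norm_eq_one hu).symm
  have hWsu : quatMatrix u ∈ Matrix.specialUnitaryGroup (Fin 2) ℂ := by rw [hW]; exact (quatToSU2 u).2
  -- the open half-guard in `SU(2)` and the `SU(2)`-valued representative of `Kmat h c`
  set S : Set (Matrix.specialUnitaryGroup (Fin 2) ℂ) :=
    {V | ∀ i, ‖h i * star (V : Matrix (Fin 2) (Fin 2) ℂ) - 1‖ < 1 / 2} with hS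
  have hSo : IsOpen S := by
    rw [hS, Set.setOf_forall]
    exact isOpen_iInter_of_finite fun i =>
      isOpen_lt ((continuous_const.mul continuous_subtype_val.star).sub continuous_const).norm continuous_const
  have huS : quatToSU2 u ∈ S := fun i => by
    show ‖h i * star ((quatToSU2 u : Matrix.specialUnitaryGroup (Fin 2) ℂ) : Matrix (Fin 2) (Fin 2) ℂ) - 1‖ < 1 / 2
    rw [← hW]; exact lt_of_le_of_lt (hg i) (by norm_num)
  classical
  set K : Matrix.specialUnitaryGroup (Fin 2) ℂ → Matrix.specialUnitaryGroup (Fin 2) ℂ := fun V =>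
    if hV : V ∈ S then ⟨Kmat h c (V : Matrix (Fin 2) (Fin 2) ℂ), Kmat_mem_specialUnitaryGroup h c hh V.2 hV⟩ else V with hK
  have hKmat : ∀ V ∈ S, Kmat h c (V : Matrix (Fin 2) (Fin 2) ℂ) =
      ((K V : Matrix.specialUnitaryGroup (Fin 2) ℂ) : Matrix (Fin 2) (Fin 2) ℂ) := fun V hV => by
    simp only [hK, dif_pos hV]
  have hd : ∀ V ∈ S, HasStrictFDerivAt (Kmat h c) (emlD h c (V : Matrix (Fin 2) (Fin 2) ℂ)) (V : Matrix (Fin 2) (Fin 2) ℂ) :=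
    fun V hV => hasStrictFDerivAt_Kmat h c fun i => lt_trans (hV i) (by norm_num)
  -- the data of the cone lemma
  set k : ℍ → ℍ := fun q => topRowQuat (Kmat h c (quatMatrix q)) with hk
  set k' : ℍ →L[ℝ] ℍ := topRowQuat.comp ((emlD h c (quatMatrix u)).comp quatMatrixCLM) with hk'
  have hkd : HasStrictFDerivAt k k' (‖u‖⁻¹ • u) := by
    rw [huu]
    have h1 : HasStrictFDerivAt (Kmat h c) (emlD h c (quatMatrix u)) (quatMatrixCLM u) := by
      rw [quatMatrixCLM_apply]; rw [hW]; exact hd _ huS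
    exact topRowQuat.hasStrictFDerivAt.comp u
      (HasStrictFDerivAt.comp u (f := fun q : ℍ => quatMatrixCLM q) h1 quatMatrixCLM.hasStrictFDerivAt)
  -- unit values near `u`
  have hnear : ∀ᶠ y in 𝓝 u, ‖‖y‖ • k (‖y‖⁻¹ • y)‖ = ‖y‖ := by
    have h0 : ∀ᶠ y : ℍ in 𝓝 u, y ≠ 0 := (isOpen_compl_singleton.mem_nhds hu0)
    have hcont : ContinuousAt (fun y : ℍ => quatToSU2 (‖y‖⁻¹ • y)) u := by
      have h1 : ContinuousAt (fun y : ℍ => ‖y‖⁻¹ • y) u :=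
        ((continuous_norm.continuousAt.inv₀ (norm_ne_zero_iff.2 hu0)).smul continuousAt_id)
      have h2 : ContinuousAt quatToSU2 (‖u‖⁻¹ • u) := by
        rw [huu]
        exact (Literature.MathematicalPhysics.QuantumLattice.continuousOn_quatToSU2).continuousAt
          (isOpen_compl_singleton.mem_nhds hu0)
      have := ContinuousAt.comp (f := fun y : ℍ => ‖y‖⁻¹ • y) h2 h1
      exact this
    have hS' : ∀ᶠ y : ℍ in 𝓝 u, quatToSU2 (‖y‖⁻¹ • y) ∈ S := by
      refine hcont.preimage_mem_nhds (hSo.mem_nhds ?_)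
      rw [huu]; exact huS
    filter_upwards [h0, hS'] with y hy0 hyS
    have hy1 : ‖‖y‖⁻¹ • y‖ = 1 := by rw [norm_smul, norm_inv, norm_norm, inv_mul_cancel₀ (norm_ne_zero_iff.2 hy0)]
    have hq : quatMatrix (‖y‖⁻¹ • y) = ((quatToSU2 (‖y‖⁻¹ • y) : Matrix.specialUnitaryGroup (Fin 2) ℂ) : Matrix (Fin 2) (Fin 2) ℂ) :=
      (coe_quatToSU2_of_norm_eq_one hy1).symm
    have hk1 : ‖k (‖y‖⁻¹ • y)‖ = 1 := by
      show ‖topRowQuat (Kmat h c (quatMatrix (‖y‖⁻¹ • y)))‖ = 1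
      rw [hq, hKmat _ hyS, topRowQuat_coe, norm_su2Quat]
    rw [norm_smul, norm_norm, hk1, mul_one]
  -- the tangent floor for `k'`
  have hbd : ∀ v : ℍ, ⟪u, v⟫ = 0 → c₀ * ‖v‖ ≤ ‖k' v‖ := by
    intro v hv
    obtain ⟨hXh, -, hvX⟩ := quatMatrix_tangent hu hv
    have hrange := apply_quatMatrix_eq_of_tangent hSo (K := K) (Kmat := Kmat h c)
      (D := fun V => emlD h c (V : Matrix (Fin 2) (Fin 2) ℂ)) hd hKmat hu huS hv
    have hk'v : k' v = topRowQuat (emlD h c (quatMatrix u) (quatMatrix v)) := by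
      simp only [hk', ContinuousLinearMap.comp_apply, quatMatrixCLM_apply]
    have hnorm : ‖k' v‖ = ‖emlD h c (quatMatrix u) (quatMatrix v)‖ := by
      rw [hk'v, ← norm_quatMatrix (topRowQuat (emlD h c (quatMatrix u) (quatMatrix v))), hW, ← hrange]
    have hXn : ‖quatMatrix (star u * v)‖ = ‖v‖ := by rw [norm_quatMatrix, norm_mul, norm_star, hu, one_mul]
    have hfl := hfloor h (quatMatrix u) (fun i => (Matrix.mem_specialUnitaryGroup_iff.1 (hh i)).1)
      (Matrix.mem_specialUnitaryGroup_iff.1 hWsu).1 hg _ hXh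
    rw [← hvX, hXn] at hfl
    rw [hnorm]; exact hfl
  obtain ⟨D, hD, hDv⟩ := exists_hasStrictFDerivAt_coneExt_lower hu0 hkd Filter.EventuallyEq.rfl hnear hc0 hc1
    (fun v hv => by simpa only [huu] using hbd v hv)
  exact ⟨D, hD, hDv⟩

end Cone

/-! ## 3. Local injectivity and the UNIFORM injectivity radius -/

section Radius

open Literature.MathematicalPhysics.QuantumFieldTheory.Balaban1983to89.T4HaarSU2LocalDiffeo (topRowQuat quatMatrixCLM quatMatrixCLM_apply)
open Literature.MathematicalPhysics.QuantumFieldTheory.Balaban1983to89.T4QuatExpLog (norm_quatMatrix quatMatrix_sub)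
open Literature.MathematicalPhysics.QuantumLattice (quatMatrix su2Quat norm_su2Quat quatToSU2 quatMatrix_su2Quat quatToSU2_su2Quat)

variable {ι : Type*} [Fintype ι]

/-- **LOCAL INJECTIVITY IN THE JOINT VARIABLES**: at a unit point over the closed guard the map `(h, x) ↦ (h, ‖x‖ • topRowQuat (Kmat h c (quatMatrix (x/‖x‖))))`
has an invertible strict derivative (block triangular, fibre block with the floor of `exists_fibreDeriv_floor`), hence is injective on an open
neighbourhood (Mathlib's inverse function theorem `HasStrictFDerivAt.toOpenPartialHomeomorph`). [folklore] -/
theorem exists_injOn_nhds (c : ι → ℝ) {c₀ : ℝ} (hc0 : 0 < c₀) (hc1 : c₀ ≤ 1)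
    (hfloor : ∀ (h : ι → Matrix (Fin 2) (Fin 2) ℂ) (W : Matrix (Fin 2) (Fin 2) ℂ),
      (∀ i, h i ∈ Matrix.unitaryGroup (Fin 2) ℂ) → W ∈ Matrix.unitaryGroup (Fin 2) ℂ → (∀ i, ‖h i * star W - 1‖ ≤ 1 / 3) →
        ∀ X : Matrix (Fin 2) (Fin 2) ℂ, Xᴴ = -X → c₀ * ‖X‖ ≤ ‖emlD h c W (W * X)‖)
    (h : ι → Matrix (Fin 2) (Fin 2) ℂ) (hh : ∀ i, h i ∈ Matrix.specialUnitaryGroup (Fin 2) ℂ)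
    {u : ℍ} (hu : ‖u‖ = 1) (hg : ∀ i, ‖h i * star (quatMatrix u) - 1‖ ≤ 1 / 3) :
    ∃ V : Set ((ι → Matrix (Fin 2) (Fin 2) ℂ) × ℍ), IsOpen V ∧ (h, u) ∈ V ∧
      InjOn (fun q : (ι → Matrix (Fin 2) (Fin 2) ℂ) × ℍ =>
        (q.1, ‖q.2‖ • topRowQuat (Kmat q.1 c (quatMatrix (‖q.2‖⁻¹ • q.2))))) V := by
  haveI : CompleteSpace (Matrix (Fin 2) (Fin 2) ℂ) := FiniteDimensional.complete ℝ _
  haveI : CompleteSpace ℍ := FiniteDimensional.complete ℝ ℍ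
  set F : (ι → Matrix (Fin 2) (Fin 2) ℂ) × ℍ → ℍ :=
    fun q => ‖q.2‖ • topRowQuat (Kmat q.1 c (quatMatrix (‖q.2‖⁻¹ • q.2))) with hF
  have hu0 : u ≠ 0 := fun h0 => by rw [h0, norm_zero] at hu; exact zero_ne_one hu
  have huu : ‖u‖⁻¹ • u = u := by rw [hu, inv_one, one_smul]
  have hg1 : ∀ i, ‖h i * star (quatMatrix (‖u‖⁻¹ • u)) - 1‖ < 1 := fun i => by
    rw [huu]; exact lt_of_le_of_lt (hg i) (by norm_num)
  -- joint strict derivative of `F` at `(h, u)`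
  have hFs : HasStrictFDerivAt F (fderiv ℝ F (h, u)) (h, u) :=
    (contDiffAt_cone c (p := (h, u)) hu0 hg1).hasStrictFDerivAt one_ne_zero
  set L₂ : ((ι → Matrix (Fin 2) (Fin 2) ℂ) × ℍ) →L[ℝ] ℍ := fderiv ℝ F (h, u) with hL₂
  -- the fibre derivative and its floor
  obtain ⟨D, hD, hDv⟩ := exists_fibreDeriv_floor c hc0 hc1 hfloor h hh hu hg
  have hfib : HasFDerivAt (fun x : ℍ => F (h, x))
      (L₂.comp (ContinuousLinearMap.inr ℝ (ι → Matrix (Fin 2) (Fin 2) ℂ) ℍ)) u :=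
    hFs.hasFDerivAt.comp u (hasFDerivAt_prodMk_right (𝕜 := ℝ) h u)
  have hDeq : L₂.comp (ContinuousLinearMap.inr ℝ (ι → Matrix (Fin 2) (Fin 2) ℂ) ℍ) = D := hfib.unique hD.hasFDerivAt
  -- the derivative of `Ψ = (fst, F)` and its injectivity
  set L : ((ι → Matrix (Fin 2) (Fin 2) ℂ) × ℍ) →L[ℝ] ((ι → Matrix (Fin 2) (Fin 2) ℂ) × ℍ) :=
    (ContinuousLinearMap.fst ℝ (ι → Matrix (Fin 2) (Fin 2) ℂ) ℍ).prod L₂ with hL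
  have hΨ : HasStrictFDerivAt (fun q : (ι → Matrix (Fin 2) (Fin 2) ℂ) × ℍ => (q.1, F q)) L (h, u) :=
    hasStrictFDerivAt_fst.prodMk hFs
  have hLinj : Function.Injective L := by
    refine (injective_iff_map_eq_zero L).2 fun q hq => ?_
    have h1 : q.1 = 0 := congrArg Prod.fst hq
    have h2 : L₂ q = 0 := congrArg Prod.snd hq
    have hq2 : q = ContinuousLinearMap.inr ℝ (ι → Matrix (Fin 2) (Fin 2) ℂ) ℍ q.2 := by
      ext1
      · simpa using h1
      · simp
    have h3 : D q.2 = 0 := by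
      rw [← hDeq, ContinuousLinearMap.comp_apply, ← hq2]; exact h2
    have h4 : q.2 = 0 := by
      have hv := hDv q.2
      rw [h3, norm_zero] at hv
      have : ‖q.2‖ ≤ 0 := by nlinarith [norm_nonneg q.2]
      exact norm_eq_zero.1 (le_antisymm this (norm_nonneg _))
    exact Prod.ext h1 h4
  set Le : ((ι → Matrix (Fin 2) (Fin 2) ℂ) × ℍ) ≃L[ℝ] ((ι → Matrix (Fin 2) (Fin 2) ℂ) × ℍ) :=
    (LinearEquiv.ofInjectiveEndo L.toLinearMap hLinj).toContinuousLinearEquiv with hLe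
  have hΨe : HasStrictFDerivAt (fun q : (ι → Matrix (Fin 2) (Fin 2) ℂ) × ℍ => (q.1, F q))
      (Le : ((ι → Matrix (Fin 2) (Fin 2) ℂ) × ℍ) →L[ℝ] ((ι → Matrix (Fin 2) (Fin 2) ℂ) × ℍ)) (h, u) :=
    hΨ.congr_fderiv (ContinuousLinearMap.ext fun q => rfl)
  refine ⟨(hΨe.toOpenPartialHomeomorph _).source, (hΨe.toOpenPartialHomeomorph _).open_source,
    hΨe.mem_toOpenPartialHomeomorph_source, ?_⟩
  exact (hΨe.toOpenPartialHomeomorph _).injOn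

omit [Fintype ι] in
/-- The compact set of unit points over the closed guard: `{(h, u) : hᵢ ∈ SU(2), ‖u‖ = 1, ‖hᵢ (quatMatrix u)* − 1‖ ≤ 1/3}`. [folklore] -/
theorem isCompact_unitGuard :
    IsCompact {p : (ι → Matrix (Fin 2) (Fin 2) ℂ) × ℍ |
      (∀ i, p.1 i ∈ Matrix.specialUnitaryGroup (Fin 2) ℂ) ∧ ‖p.2‖ = 1 ∧ ∀ i, ‖p.1 i * star (quatMatrix p.2) - 1‖ ≤ 1 / 3} := by
  haveI : ProperSpace ℍ := FiniteDimensional.proper ℝ ℍ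
  have hSU : IsCompact (Matrix.specialUnitaryGroup (Fin 2) ℂ : Set (Matrix (Fin 2) (Fin 2) ℂ)) :=
    isCompact_iff_compactSpace.mpr Matrix.specialUnitaryGroup.instCompactSpace
  have hbig : IsCompact ((Set.univ.pi fun _ : ι => (Matrix.specialUnitaryGroup (Fin 2) ℂ : Set (Matrix (Fin 2) (Fin 2) ℂ))) ×ˢ
      sphere (0 : ℍ) 1) := (isCompact_univ_pi fun _ => hSU).prod (isCompact_sphere 0 1)
  have hqc : Continuous fun q : ℍ => quatMatrix q := by
    have e : (fun q : ℍ => quatMatrix q) = fun q => quatMatrixCLM q := by funext q; rw [quatMatrixCLM_apply]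
    rw [e]; exact quatMatrixCLM.continuous
  refine hbig.of_isClosed_subset ?_ ?_
  · rw [Set.setOf_and, Set.setOf_and]
    refine IsClosed.inter ?_ (IsClosed.inter (isClosed_eq (continuous_norm.comp continuous_snd) continuous_const) ?_)
    · rw [Set.setOf_forall]
      exact isClosed_iInter fun i => hSU.isClosed.preimage ((continuous_apply i).comp continuous_fst)
    · rw [Set.setOf_forall]
      refine isClosed_iInter fun i => ?_
      have hc : Continuous fun p : (ι → Matrix (Fin 2) (Fin 2) ℂ) × ℍ => p.1 i * star (quatMatrix p.2) :=
        ((continuous_apply i).comp continuous_fst).mul ((hqc.comp continuous_snd).star)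
      exact isClosed_le (hc.sub continuous_const).norm continuous_const
  · rintro p ⟨h1, h2, -⟩
    exact ⟨fun i _ => h1 i, mem_sphere_zero_iff_norm.mpr h2⟩

/-- **THE UNIFORM INJECTIVITY RADIUS (quaternion form)**: there is `r > 0` such that for ALL `hᵢ ∈ SU(2)` and unit quaternions `u₁, u₂` over the
closed guard with `‖u₁ − u₂‖ < r`, equality of the cone extensions at `(h, u₁)`, `(h, u₂)` forces `u₁ = u₂` (local injectivity + compactness
+ Lebesgue number). [folklore] -/
theorem exists_uniform_injRadius (c : ι → ℝ) {c₀ : ℝ} (hc0 : 0 < c₀) (hc1 : c₀ ≤ 1)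
    (hfloor : ∀ (h : ι → Matrix (Fin 2) (Fin 2) ℂ) (W : Matrix (Fin 2) (Fin 2) ℂ),
      (∀ i, h i ∈ Matrix.unitaryGroup (Fin 2) ℂ) → W ∈ Matrix.unitaryGroup (Fin 2) ℂ → (∀ i, ‖h i * star W - 1‖ ≤ 1 / 3) →
        ∀ X : Matrix (Fin 2) (Fin 2) ℂ, Xᴴ = -X → c₀ * ‖X‖ ≤ ‖emlD h c W (W * X)‖) :
    ∃ r : ℝ, 0 < r ∧ ∀ (h : ι → Matrix (Fin 2) (Fin 2) ℂ), (∀ i, h i ∈ Matrix.specialUnitaryGroup (Fin 2) ℂ) →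
      ∀ u₁ u₂ : ℍ, ‖u₁‖ = 1 → ‖u₂‖ = 1 → (∀ i, ‖h i * star (quatMatrix u₁) - 1‖ ≤ 1 / 3) →
        (∀ i, ‖h i * star (quatMatrix u₂) - 1‖ ≤ 1 / 3) → ‖u₁ - u₂‖ < r →
        ‖u₁‖ • topRowQuat (Kmat h c (quatMatrix (‖u₁‖⁻¹ • u₁))) = ‖u₂‖ • topRowQuat (Kmat h c (quatMatrix (‖u₂‖⁻¹ • u₂))) →
        u₁ = u₂ := by
  set C₁ : Set ((ι → Matrix (Fin 2) (Fin 2) ℂ) × ℍ) := {p |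
      (∀ i, p.1 i ∈ Matrix.specialUnitaryGroup (Fin 2) ℂ) ∧ ‖p.2‖ = 1 ∧ ∀ i, ‖p.1 i * star (quatMatrix p.2) - 1‖ ≤ 1 / 3} with hC₁
  have hC : IsCompact C₁ := isCompact_unitGuard
  have key : ∀ p : C₁, ∃ V : Set ((ι → Matrix (Fin 2) (Fin 2) ℂ) × ℍ), IsOpen V ∧ (p : (ι → Matrix (Fin 2) (Fin 2) ℂ) × ℍ) ∈ V ∧
      InjOn (fun q : (ι → Matrix (Fin 2) (Fin 2) ℂ) × ℍ =>
        (q.1, ‖q.2‖ • topRowQuat (Kmat q.1 c (quatMatrix (‖q.2‖⁻¹ • q.2))))) V := fun p =>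
    exists_injOn_nhds c hc0 hc1 hfloor p.1.1 p.2.1 p.2.2.1 p.2.2.2
  choose V hVo hVm hVi using key
  obtain ⟨δ, hδ, hcover⟩ := lebesgue_number_lemma_of_metric hC hVo (fun p hp => Set.mem_iUnion.2 ⟨⟨p, hp⟩, hVm ⟨p, hp⟩⟩)
  refine ⟨δ, hδ, fun h hh u₁ u₂ hu₁ hu₂ hg₁ hg₂ hdist heq => ?_⟩
  have hp₁ : ((h, u₁) : (ι → Matrix (Fin 2) (Fin 2) ℂ) × ℍ) ∈ C₁ := ⟨hh, hu₁, hg₁⟩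
  obtain ⟨i, hi⟩ := hcover _ hp₁
  have hm₁ : ((h, u₁) : (ι → Matrix (Fin 2) (Fin 2) ℂ) × ℍ) ∈ V i := hi (mem_ball_self hδ)
  have hm₂ : ((h, u₂) : (ι → Matrix (Fin 2) (Fin 2) ℂ) × ℍ) ∈ V i := by
    refine hi ?_
    rw [mem_ball, Prod.dist_eq, dist_self, dist_eq_norm, ← norm_neg, neg_sub]
    exact max_lt_iff.2 ⟨lt_of_le_of_lt le_rfl (by linarith [norm_nonneg (u₁ - u₂)]), hdist⟩
  have hΨeq := hVi i hm₁ hm₂ (Prod.ext rfl heq)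
  exact congrArg Prod.snd hΨeq

/-- **THE UNIFORM INJECTIVITY RADIUS OF THE EXP-MEAN-LOG FIBRE MAP ON `SU(2)`** (matrix form): there is `r > 0` such that for ALL
`hᵢ ∈ SU(2)` and `W₁, W₂ ∈ SU(2)` over the closed guard `‖hᵢ W* − 1‖ ≤ 1/3` with `‖W₁ − W₂‖ < r`, `Kmat h c W₁ = Kmat h c W₂ ⟹ W₁ = W₂`.
[folklore] -/
theorem exists_uniform_injRadius_su2 (c : ι → ℝ) {c₀ : ℝ} (hc0 : 0 < c₀) (hc1 : c₀ ≤ 1)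
    (hfloor : ∀ (h : ι → Matrix (Fin 2) (Fin 2) ℂ) (W : Matrix (Fin 2) (Fin 2) ℂ),
      (∀ i, h i ∈ Matrix.unitaryGroup (Fin 2) ℂ) → W ∈ Matrix.unitaryGroup (Fin 2) ℂ → (∀ i, ‖h i * star W - 1‖ ≤ 1 / 3) →
        ∀ X : Matrix (Fin 2) (Fin 2) ℂ, Xᴴ = -X → c₀ * ‖X‖ ≤ ‖emlD h c W (W * X)‖) :
    ∃ r : ℝ, 0 < r ∧ ∀ (h : ι → Matrix (Fin 2) (Fin 2) ℂ), (∀ i, h i ∈ Matrix.specialUnitaryGroup (Fin 2) ℂ) →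
      ∀ W₁ W₂ : Matrix.specialUnitaryGroup (Fin 2) ℂ,
        (∀ i, ‖h i * star (W₁ : Matrix (Fin 2) (Fin 2) ℂ) - 1‖ ≤ 1 / 3) →
        (∀ i, ‖h i * star (W₂ : Matrix (Fin 2) (Fin 2) ℂ) - 1‖ ≤ 1 / 3) →
        ‖(W₁ : Matrix (Fin 2) (Fin 2) ℂ) - W₂‖ < r →
        Kmat h c (W₁ : Matrix (Fin 2) (Fin 2) ℂ) = Kmat h c (W₂ : Matrix (Fin 2) (Fin 2) ℂ) → W₁ = W₂ := by
  obtain ⟨r, hr, hR⟩ := exists_uniform_injRadius c hc0 hc1 hfloor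
  refine ⟨r, hr, fun h hh W₁ W₂ hg₁ hg₂ hdist hK => ?_⟩
  have hq₁ : quatMatrix (su2Quat W₁) = (W₁ : Matrix (Fin 2) (Fin 2) ℂ) := quatMatrix_su2Quat W₁
  have hq₂ : quatMatrix (su2Quat W₂) = (W₂ : Matrix (Fin 2) (Fin 2) ℂ) := quatMatrix_su2Quat W₂
  have hn₁ : ‖su2Quat W₁‖ = 1 := norm_su2Quat W₁
  have hn₂ : ‖su2Quat W₂‖ = 1 := norm_su2Quat W₂
  have hdist' : ‖su2Quat W₁ - su2Quat W₂‖ < r := by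
    rw [← norm_quatMatrix, quatMatrix_sub, hq₁, hq₂]; exact hdist
  have heq : ‖su2Quat W₁‖ • topRowQuat (Kmat h c (quatMatrix (‖su2Quat W₁‖⁻¹ • su2Quat W₁))) =
      ‖su2Quat W₂‖ • topRowQuat (Kmat h c (quatMatrix (‖su2Quat W₂‖⁻¹ • su2Quat W₂))) := by
    rw [hn₁, hn₂, inv_one, one_smul, one_smul, one_smul, one_smul, hq₁, hq₂, hK]
  have hu := hR h hh (su2Quat W₁) (su2Quat W₂) hn₁ hn₂ (by rw [hq₁]; exact hg₁) (by rw [hq₂]; exact hg₂) hdist' heq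
  rw [← quatToSU2_su2Quat W₁, ← quatToSU2_su2Quat W₂, hu]

end Radius

end Summit.QuantumFields.YangMills.Theorems.HeightChiSqLEmlInjectivity

end
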